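import Literature.NumberTheory.EllipticCurves.KuriharaNumber
import Literature.NumberTheory.EllipticCurves.CuspFormLFunction
import Literature.NumberTheory.EllipticCurves.GlobalMinimalModel

/-!  bsd-idea-19 g26 (lens dual) — First-lemma sketches for the crux idea `twisted-lvalue-digit` on
stmt-BirchSwinnertonDyer-21116.  Nothing here is proved; the point is that the statements elaborate
over existing declarations. -/

namespace Summit.BirchSwinnertonDyer.BirchSwinnertonDyer.Cruxes.EisensteinHalfFiveLeRest.TwistedLValueDigit

open Literature.NumberTheory.EllipticCurves Literature.NumberTheory.EllipticCurves.ModularForms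
open Literature.NumberTheory.DiophantineGeometry.Dioph (ratModP)

/-- **(C0) total-sum checksum** = Theorem D(v) of `Lines/kurihara-dual-digit.md`: at a two-prime level
`n = ℓ₁ ℓ₂` (distinct primes not dividing the level), `∑_{a ∈ (ℤ/n)ˣ} [a/n]⁺ = (a_{ℓ₁} - 2)(a_{ℓ₂} - 2) [0]⁺`
(Hecke relation `T_ℓ {∞ → 0}` twice).  Here `a_ℓ = W.frobeniusTrace ℓ` for the curve's newform. -/
theorem firstLemma_totalSum (W : WeierstrassCurve ℚ) [W.IsElliptic] [W.IsGloballyMinimal]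
    {N : ℕ} [NeZero N] (f : CuspForm (CongruenceSubgroup.Gamma0 N) 2) (hf : IsNewformOf W f)
    (ℓ₁ ℓ₂ : ℕ) (h₁ : ℓ₁.Prime) (h₂ : ℓ₂.Prime) (hne : ℓ₁ ≠ ℓ₂) (hN₁ : ¬ ℓ₁ ∣ N) (hN₂ : ¬ ℓ₂ ∣ N)
    [NeZero (ℓ₁ * ℓ₂)] :
    ∑ a : (ZMod (ℓ₁ * ℓ₂))ˣ, ratPlusSymbol f (((a : ZMod (ℓ₁ * ℓ₂)).val : ℚ) / (ℓ₁ * ℓ₂ : ℕ))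
      = ((W.frobeniusTrace ℓ₁ - 2) * (W.frobeniusTrace ℓ₂ - 2) : ℤ) * ratPlusSymbol f 0 := by
  sorry

/-- **(C1) first-moment vanishing** = Theorem D(i) at `|e| = 1 < ν = 2`: for Kolyvagin primes
(`p ∣ ℓᵢ - 1`, `a_{ℓᵢ} ≡ ℓᵢ + 1 (mod p)`) and any discrete logarithms `ψ_ℓ : (ℤ/ℓ)ˣ →* ℤ/p`,
`∑_a [a/n]⁺ ψ_{ℓ₁}(a) = 0` in `ℤ/p` (p-integrality of the symbols assumed via `ratModP`). -/
theorem firstLemma_firstMoment (W : WeierstrassCurve ℚ) [W.IsElliptic] [W.IsGloballyMinimal]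
    {N : ℕ} [NeZero N] (f : CuspForm (CongruenceSubgroup.Gamma0 N) 2) (hf : IsNewformOf W f)
    (p ℓ₁ ℓ₂ : ℕ) [Fact p.Prime] (hp : 5 ≤ p) (h₁ : ℓ₁.Prime) (h₂ : ℓ₂.Prime) (hne : ℓ₁ ≠ ℓ₂)
    (hN₁ : ¬ ℓ₁ ∣ N) (hN₂ : ¬ ℓ₂ ∣ N) (hk₁ : (p : ℤ) ∣ ℓ₁ - 1) (hk₂ : (p : ℤ) ∣ ℓ₂ - 1)
    (ha₁ : (p : ℤ) ∣ W.frobeniusTrace ℓ₁ - 2) (ha₂ : (p : ℤ) ∣ W.frobeniusTrace ℓ₂ - 2)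
    (hint : ∀ r : ℚ, ¬ (p : ℤ) ∣ (ratPlusSymbol f r).den)
    (ψ₁ : (ZMod ℓ₁)ˣ →* Multiplicative (ZMod p)) [NeZero (ℓ₁ * ℓ₂)] :
    ∑ a : (ZMod (ℓ₁ * ℓ₂))ˣ,
        ratModP p (ratPlusSymbol f (((a : ZMod (ℓ₁ * ℓ₂)).val : ℚ) / (ℓ₁ * ℓ₂ : ℕ)))
          * Multiplicative.toAdd (ψ₁ (ZMod.unitsMap (Dvd.intro ℓ₂ rfl) a)) = 0 := by
  sorry

end Summit.BirchSwinnertonDyer.BirchSwinnertonDyer.Cruxes.EisensteinHalfFiveLeRest.TwistedLValueDigit
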